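/-
COR-CM (cells pub-hodgecm / pub-hodgecm2, stage 2 of the Hodge ladder) — TRANSPOSITION SURGE, item (vi): HM-EQUALITY Δ1 KERNEL
WITNESS (coordinator ruling 2026-08-21T19:17:21Z «Δ1 = EITHER prove `S.TranslateClosed heckeFamily` from tree facts OR re-type the
display without it if the chain does not consume it — the RED TEAM decides WHICH (kernel witness either way), then own-htheta / b01-x1
executes»; red-team file hodge-director/HM-EQUALITY.md §2 (Δ1)).  Seat prover-pub-hodgecm-own-htheta-g3-0 (own-htheta gen 3, owner of
the item-(vi) lineage).  NEW file, theorems only: no definition, no instance, no named fact, nothing asserted, no proof holes; no landed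
file is touched.  FRAMING: HC_CM is NOT proved; B01-O is NOT closed.

THE WITNESS.  In the tree display of record `Model.hc_cm_of_jointThetaPin_meeting[_rec]` (`CorCM/B01/FaceWedgeMeetJointMeeting.lean`
:133/:172, p292271) the clause [C0] `S.TranslateClosed (Transposition.Model.heckeFamily …)` is a TREE THEOREM whenever the supply datum
`S` is the SATURATED one, `Transposition.FaceThetaSupply.ofUiso` (`Θ_i(Γ) := U_{Ψ i}(Γ)_σ`): `FaceThetaSupply.translateClosed_ofUiso`
(`Transposition/Item6Holds.lean`:129, from `Fact_pull_comp` alone = `Universe.pullC_mem_Uiso`, `B01/PeriodExpansion.lean`:52) — and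
the S side of the term of record delivers exactly a saturated supply: B01-S `U.FaceSupply` (what the pinned junctions
`Model.faceSupply_of_thm418AsPrinted_pinned[_def411]` conclude) gives `ofUiso` per face.  Feeding `S := ofUiso …`,
`[C0] := translateClosed_ofUiso …` into the display of record leaves EXACTLY x2's SPLIT meeting-form display
`Model.hc_cm_of_supply_of_settingMeetSat_embOf[_rec]` (`CorCM/B01/FaceWedgeOverlapBypassMeeting.lean`:259/:297, p295997): its two
hypotheses {`hS` = B01-S, `hM` = Siso + C5′ at the saturated (12)-sets + C6′} and NO translate-closure clause.  So at the saturated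
supply the two branches of the ruling COINCIDE: [C0] is PROVED from tree facts, and the display WITHOUT it is p295997 — this file
derives the JOINT HYPOTHESIS of p292271's display (its `h`, per face: `∃ ι₁ V σ S … Siso, [C0] ∧ C5′ ∧ C6′`) from p295997's two
hypotheses {`hS`, `hM`} (`jointMeetingDatum_of_supply_of_settingMeetSat[_rec]`); applying p292271 to it gives back p295997's display
(same proposition — the gate's dedup lint forbids restating it, so that composition is left to the reader: `hc_cm_of_jointThetaPin_meeting_rec
(jointMeetingDatum_of_supply_of_settingMeetSat_rec hS hM)`).
WHAT IT DOES NOT SAY: for a NON-saturated supply (genuine theta sets `Θ_i(Γ) ⊊ U_{Ψ i}(Γ)`, the package's `ThetaRealisation₂.Theta`)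
[C0] is load-bearing (it feeds `wedge_of_translateClosed_heckeFamily`) and reduces in the tree to the existence-shape stability
`LiftTranslate` (`Transposition.Model.translateClosed_heckeFamily_of_liftTranslate`, `Item6HeckeTranslateClosed.lean`:157; b01-x1's
`FaceWedgeMeetJointLift.lean` clause (1ᴸ)); and at the saturated supply the (12)-meeting clause is C5′ at SATURATED sets — its
relation to the package's `gen12Meet` at genuine theta sets is the exhaustion item (E) of p295997's header (own-b01 / x2 lane), not Δ1.
-/
import Summits.HodgeConjecture.CorCM.B01.FaceWedgeMeetJointMeeting
import Summits.HodgeConjecture.CorCM.B01.FaceWedgeOverlapBypassMeeting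
import Summits.HodgeConjecture.CorCM.B01.Transposition.Item6Holds
import HarnessLib

/-!
# HM-EQUALITY Δ1: `TranslateClosed` is a tree theorem at the saturated supply; the display without it is p295997

Namespace `Summit.HodgeConjecture.CorCM.Model`.
* `jointMeetingDatum_of_supply_of_settingMeetSat` — on `U = picardCMUniverse hHD hI h₁ h₃`: B01-S `hS : U.FaceSupply` and x2's
  theta-side meeting binder `hM` (VERBATIM the `hM` of `hc_cm_of_supply_of_settingMeetSat_embOf`, p295997 :259) give the per-face JOINT
  HYPOTHESIS `h` of the display of record `hc_cm_of_jointThetaPin_meeting` (p292271 :133) VERBATIM — with `S := FaceThetaSupply.ofUiso …`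
  (from `hS` via `Transposition.exists_supply_witness ∘ faceThetaSupplyWedgeExists_of_faceSupply'`), `σ := ι₁`, [C0]
  `:= FaceThetaSupply.translateClosed_ofUiso (universeOf_fact_pull_comp …) …`, and the two meeting clauses read off `hM` at
  `S.Theta i Γ = U_{ψ i}(Γ)_{ι₁}` (definitional).
* `jointMeetingDatum_of_supply_of_settingMeetSat_rec` — the same on the universe OF RECORD: from `U_rec.FaceSupply` and p295997 :297's
  `hM`, the hypothesis of `hc_cm_of_jointThetaPin_meeting_rec` (:172) VERBATIM.  Hence the (β)-free END displays of
  `Transposition/Item6SupplyPinnedRetyped.lean` (p300636), which compose the pinned S2 junctions with p295997 BY NAME, factor through the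
  display of record p292271 with `S` saturated and [C0] discharged.
HC_CM is NOT proved: `hS`, `hM` are inhabited by no one.
-/

noncomputable section

set_option autoImplicit false

open scoped TensorProduct InnerProductSpace
open MeasureTheory
open Literature.AlgebraicGeometry.HodgeTheory
open Literature.NumberTheory.Automorphic
open Literature.NumberTheory.Automorphic.PicardCM

namespace Summit.HodgeConjecture.CorCM

open Literature.AlgebraicGeometry.Motives (CMType HodgeStructure)
open Literature.AlgebraicGeometry.Motives.HodgeStructure (conj)
open Prior.Perl34File (Perl34.IsolationSetting)
open Prior.Perl34File.Perl34
open Transposition (FaceThetaSupply)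

namespace Model

/-- **HM-EQUALITY Δ1 witness — the JOINT HYPOTHESIS of the display of record p292271 from p295997's split pair {`hS`, `hM`}, with the
SATURATED supply and [C0] `TranslateClosed` DISCHARGED by the tree theorem `FaceThetaSupply.translateClosed_ofUiso`.**  Per face: `hS`
gives an admissible `ι₁`, a `V` and non-zero `ω₀ ∈ U_{ψ₀}(Γ)`, `ω₁ ∈ U_{ψ₁}(Γ)` (`exists_supply_witness`, B01-H inside
`faceThetaSupplyWedgeExists_of_faceSupply'`); `S := ofUiso U F f.psi ι₁ ⟨Γ, …⟩`, `σ := ι₁`; translate-closure of `S` along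
`Transposition.Model.heckeFamily` is `translateClosed_ofUiso (universeOf_fact_pull_comp …)` (`U_Ψ` is pull-back stable along every
morphism of the tower, `Fact_pull_comp` alone); the meeting clauses are `hM`'s.  The conclusion is the `h` of
`hc_cm_of_jointThetaPin_meeting` token for token, so `hc_cm_of_jointThetaPin_meeting hHD hI h₁ h₃ hR (this hS hM) : HC_CM`.
HC_CM is NOT proved: `hS`, `hM` are inhabited by no one. [folklore] -/
theorem jointMeetingDatum_of_supply_of_settingMeetSat (hHD : exists_isReal_hodgeModel) (hI : hodgePQ_independent_of_hodgeModel)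
    (h₁ : BallQuotientUniformised) (h₃ : CMAbelianVarietyRealised)
    (hS : (picardCMUniverse hHD hI h₁ h₃).FaceSupply)
    (hM : ∀ (F : CMField), IsGalois ℚ F → 6 ≤ Module.finrank ℚ F → ∀ (f : Face F) (ι₁ : F →+* ℂ), f.Admissible ι₁ →
      ∀ V : HermSpace3 F ι₁,
      ∃ (H CG G SK SigIdx SigIdxG : Type) (_ : NormedAddCommGroup H) (_ : InnerProductSpace ℂ H) (_ : CompleteSpace H)
        (_ : NormedAddCommGroup CG) (_ : NormedSpace ℂ CG) (_ : Group G) (_ : TopologicalSpace G) (_ : TopologicalSpace SK)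
        (S : Perl34.IsolationSetting H (Lp ℂ 2 V.autMeasure) CG G SK SigIdx SigIdxG),
        (∀ (Γ : Level V) (ω₁ ω₂ : (picardCMUniverse hHD hI h₁ h₃).CohC ((picardCMUniverse hHD hI h₁ h₃).pms F ι₁ V Γ) 1),
          ω₁ ∈ (picardCMUniverse hHD hI h₁ h₃).Uiso Γ F (f.psi 0) ι₁ → ω₂ ∈ (picardCMUniverse hHD hI h₁ h₃).Uiso Γ F (f.psi 1) ι₁ →
            embOf hHD hI (ballQuotientUniformisedDatum_of h₁) h₃ Γ
                ((picardCMUniverse hHD hI h₁ h₃).cup2C ((picardCMUniverse hHD hI h₁ h₃).pms F ι₁ V Γ) 1 ω₁ ω₂) ≠ 0 →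
              ∃ u ∈ S.t12.S12,
                ⟪embOf hHD hI (ballQuotientUniformisedDatum_of h₁) h₃ Γ
                    ((picardCMUniverse hHD hI h₁ h₃).cup2C ((picardCMUniverse hHD hI h₁ h₃).pms F ι₁ V Γ) 1 ω₁ ω₂), u⟫_ℂ ≠ 0) ∧
        (∀ χ : S.t34.X, S.t34.allowed χ → ∀ (Φ : SK) (Γ₁ : Level V)
          (ω₁ ω₂ : (picardCMUniverse hHD hI h₁ h₃).CohC ((picardCMUniverse hHD hI h₁ h₃).pms F ι₁ V Γ₁) 1),
          ω₁ ∈ (picardCMUniverse hHD hI h₁ h₃).Uiso Γ₁ F (f.psi 0) ι₁ →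
          ω₂ ∈ (picardCMUniverse hHD hI h₁ h₃).Uiso Γ₁ F (f.psi 1) ι₁ →
            ⟪embOf hHD hI (ballQuotientUniformisedDatum_of h₁) h₃ Γ₁
                ((picardCMUniverse hHD hI h₁ h₃).cup2C ((picardCMUniverse hHD hI h₁ h₃).pms F ι₁ V Γ₁) 1 ω₁ ω₂),
              S.t34.ϑ χ Φ⟫_ℂ ≠ 0 →
              ∃ (Γ : Level V) (ω : Fin 4 → (picardCMUniverse hHD hI h₁ h₃).CohC ((picardCMUniverse hHD hI h₁ h₃).pms F ι₁ V Γ) 1),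
                (∀ i, ω i ∈ (picardCMUniverse hHD hI h₁ h₃).Uiso Γ F (f.psi i) ι₁) ∧
                  ⟪embOf hHD hI (ballQuotientUniformisedDatum_of h₁) h₃ Γ
                      ((picardCMUniverse hHD hI h₁ h₃).cup2C ((picardCMUniverse hHD hI h₁ h₃).pms F ι₁ V Γ) 1 (ω 2) (ω 3)),
                    embOf hHD hI (ballQuotientUniformisedDatum_of h₁) h₃ Γ
                      ((picardCMUniverse hHD hI h₁ h₃).cup2C ((picardCMUniverse hHD hI h₁ h₃).pms F ι₁ V Γ) 1 (ω 0) (ω 1))⟫_ℂ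
                    ≠ 0)) :
    ∀ (F : CMField), IsGalois ℚ F → 6 ≤ Module.finrank ℚ F → ∀ f : Face F,
      ∃ (ι₁ : F →+* ℂ) (V : HermSpace3 F ι₁) (σ : F →+* ℂ)
        (S : FaceThetaSupply (picardCMUniverse hHD hI h₁ h₃) ι₁ V F f.psi σ)
        (H CG G SK SigIdx SigIdxG : Type)
        (_ : NormedAddCommGroup H) (_ : InnerProductSpace ℂ H) (_ : CompleteSpace H)
        (_ : NormedAddCommGroup CG) (_ : NormedSpace ℂ CG) (_ : Group G) (_ : TopologicalSpace G) (_ : TopologicalSpace SK)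
        (Siso : Perl34.IsolationSetting H (Lp ℂ 2 V.autMeasure) CG G SK SigIdx SigIdxG),
        S.TranslateClosed (Transposition.Model.heckeFamily hHD hI h₁ h₃) ∧
        (∀ (Γ : Level V) (ω₁ ω₂ : (picardCMUniverse hHD hI h₁ h₃).CohC ((picardCMUniverse hHD hI h₁ h₃).pms F ι₁ V Γ) 1),
          ω₁ ∈ S.Theta 0 Γ → ω₂ ∈ S.Theta 1 Γ →
          embOf hHD hI (ballQuotientUniformisedDatum_of h₁) h₃ Γ
              ((picardCMUniverse hHD hI h₁ h₃).cup2C ((picardCMUniverse hHD hI h₁ h₃).pms F ι₁ V Γ) 1 ω₁ ω₂) ≠ 0 →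
            ∃ u ∈ Siso.t12.S12,
              ⟪embOf hHD hI (ballQuotientUniformisedDatum_of h₁) h₃ Γ
                  ((picardCMUniverse hHD hI h₁ h₃).cup2C ((picardCMUniverse hHD hI h₁ h₃).pms F ι₁ V Γ) 1 ω₁ ω₂), u⟫_ℂ ≠ 0) ∧
        (∀ χ : Siso.t34.X, Siso.t34.allowed χ → ∀ (Φ : SK) (Γ₁ : Level V)
          (ω₁ ω₂ : (picardCMUniverse hHD hI h₁ h₃).CohC ((picardCMUniverse hHD hI h₁ h₃).pms F ι₁ V Γ₁) 1),
          ω₁ ∈ (picardCMUniverse hHD hI h₁ h₃).Uiso Γ₁ F (f.psi 0) σ →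
          ω₂ ∈ (picardCMUniverse hHD hI h₁ h₃).Uiso Γ₁ F (f.psi 1) σ →
            ⟪embOf hHD hI (ballQuotientUniformisedDatum_of h₁) h₃ Γ₁
                ((picardCMUniverse hHD hI h₁ h₃).cup2C ((picardCMUniverse hHD hI h₁ h₃).pms F ι₁ V Γ₁) 1 ω₁ ω₂),
              Siso.t34.ϑ χ Φ⟫_ℂ ≠ 0 →
              ∃ (Γ : Level V) (ω : Fin 4 → (picardCMUniverse hHD hI h₁ h₃).CohC ((picardCMUniverse hHD hI h₁ h₃).pms F ι₁ V Γ) 1),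
                (∀ i, ω i ∈ (picardCMUniverse hHD hI h₁ h₃).Uiso Γ F (f.psi i) σ) ∧
                ⟪embOf hHD hI (ballQuotientUniformisedDatum_of h₁) h₃ Γ
                    ((picardCMUniverse hHD hI h₁ h₃).cup2C ((picardCMUniverse hHD hI h₁ h₃).pms F ι₁ V Γ) 1 (ω 2) (ω 3)),
                  embOf hHD hI (ballQuotientUniformisedDatum_of h₁) h₃ Γ
                    ((picardCMUniverse hHD hI h₁ h₃).cup2C ((picardCMUniverse hHD hI h₁ h₃).pms F ι₁ V Γ) 1 (ω 0) (ω 1))⟫_ℂ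
                  ≠ 0) := by
  intro F hG h6 f
  obtain ⟨ι₁, hι, V, Γ, ω₀, ω₁, h0, h1, hne₀, hne₁⟩ :=
    Transposition.exists_supply_witness (faceThetaSupplyWedgeExists_of_faceSupply' hHD hI h₁ h₃ hS) F hG h6 f
  obtain ⟨H, CG, G, SK, SigIdx, SigIdxG, i1, i2, i3, i4, i5, i6, i7, i8, Siso, hg, hr⟩ := hM F hG h6 f ι₁ hι V
  exact ⟨ι₁, V, ι₁,
    Transposition.FaceThetaSupply.ofUiso (picardCMUniverse hHD hI h₁ h₃) F f.psi ι₁ ⟨Γ, ⟨ω₀, h0, hne₀⟩, ⟨ω₁, h1, hne₁⟩⟩,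
    H, CG, G, SK, SigIdx, SigIdxG, i1, i2, i3, i4, i5, i6, i7, i8, Siso,
    Transposition.FaceThetaSupply.translateClosed_ofUiso
      (universeOf_fact_pull_comp hHD hI (ballQuotientUniformisedDatum_of h₁) h₃) F f.psi ι₁ _
      (Transposition.Model.heckeFamily hHD hI h₁ h₃),
    fun Γ' η₁ η₂ hη₁ hη₂ ↦ hg Γ' η₁ η₂ hη₁ hη₂, hr⟩

/-- **The same on the universe OF RECORD**: from `U_rec.FaceSupply` and p295997 :297's theta-side binder `hM`, the hypothesis of the
display of record `hc_cm_of_jointThetaPin_meeting_rec` (`FaceWedgeMeetJointMeeting.lean`:172) VERBATIM (`let U := U_rec`,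
`let hU := ballQuotientUniformisedDatum_of ballQuotientUniformised_holds`).  So on `U_rec` the display of record, fed by the S side's
saturated supply, carries NO undischarged translate-closure clause; what it carries is p295997's `hM`.  HC_CM is NOT proved. [folklore] -/
theorem jointMeetingDatum_of_supply_of_settingMeetSat_rec :
    let U := picardCMUniverse exists_isReal_hodgeModel_holds hodgePQ_independent_of_hodgeModel_holds
      BallQuotient.ballQuotientUniformised_holds cmAbelianVarietyRealised_holds
    let hU := ballQuotientUniformisedDatum_of BallQuotient.ballQuotientUniformised_holds
    U.FaceSupply →
        (∀ (F : CMField), IsGalois ℚ F → 6 ≤ Module.finrank ℚ F → ∀ (f : Face F) (ι₁ : F →+* ℂ), f.Admissible ι₁ →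
      ∀ V : HermSpace3 F ι₁,
      ∃ (H CG G SK SigIdx SigIdxG : Type) (_ : NormedAddCommGroup H) (_ : InnerProductSpace ℂ H) (_ : CompleteSpace H)
        (_ : NormedAddCommGroup CG) (_ : NormedSpace ℂ CG) (_ : Group G) (_ : TopologicalSpace G) (_ : TopologicalSpace SK)
        (S : Perl34.IsolationSetting H (Lp ℂ 2 V.autMeasure) CG G SK SigIdx SigIdxG),
        (∀ (Γ : Level V) (ω₁ ω₂ : U.CohC (U.pms F ι₁ V Γ) 1),
          ω₁ ∈ U.Uiso Γ F (f.psi 0) ι₁ → ω₂ ∈ U.Uiso Γ F (f.psi 1) ι₁ →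
            embOf exists_isReal_hodgeModel_holds hodgePQ_independent_of_hodgeModel_holds hU cmAbelianVarietyRealised_holds Γ
                (U.cup2C (U.pms F ι₁ V Γ) 1 ω₁ ω₂) ≠ 0 →
              ∃ u ∈ S.t12.S12,
                ⟪embOf exists_isReal_hodgeModel_holds hodgePQ_independent_of_hodgeModel_holds hU cmAbelianVarietyRealised_holds Γ
                    (U.cup2C (U.pms F ι₁ V Γ) 1 ω₁ ω₂), u⟫_ℂ ≠ 0) ∧
        (∀ χ : S.t34.X, S.t34.allowed χ → ∀ (Φ : SK) (Γ₁ : Level V)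
          (ω₁ ω₂ : U.CohC (U.pms F ι₁ V Γ₁) 1),
          ω₁ ∈ U.Uiso Γ₁ F (f.psi 0) ι₁ →
          ω₂ ∈ U.Uiso Γ₁ F (f.psi 1) ι₁ →
            ⟪embOf exists_isReal_hodgeModel_holds hodgePQ_independent_of_hodgeModel_holds hU cmAbelianVarietyRealised_holds Γ₁
                (U.cup2C (U.pms F ι₁ V Γ₁) 1 ω₁ ω₂),
              S.t34.ϑ χ Φ⟫_ℂ ≠ 0 →
              ∃ (Γ : Level V) (ω : Fin 4 → U.CohC (U.pms F ι₁ V Γ) 1),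
                (∀ i, ω i ∈ U.Uiso Γ F (f.psi i) ι₁) ∧
                  ⟪embOf exists_isReal_hodgeModel_holds hodgePQ_independent_of_hodgeModel_holds hU cmAbelianVarietyRealised_holds Γ
                      (U.cup2C (U.pms F ι₁ V Γ) 1 (ω 2) (ω 3)),
                    embOf exists_isReal_hodgeModel_holds hodgePQ_independent_of_hodgeModel_holds hU cmAbelianVarietyRealised_holds Γ
                      (U.cup2C (U.pms F ι₁ V Γ) 1 (ω 0) (ω 1))⟫_ℂ
                    ≠ 0)) →
        (∀ (F : CMField), IsGalois ℚ F → 6 ≤ Module.finrank ℚ F → ∀ f : Face F,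
      ∃ (ι₁ : F →+* ℂ) (V : HermSpace3 F ι₁) (σ : F →+* ℂ)
        (S : FaceThetaSupply U ι₁ V F f.psi σ)
        (H CG G SK SigIdx SigIdxG : Type)
        (_ : NormedAddCommGroup H) (_ : InnerProductSpace ℂ H) (_ : CompleteSpace H)
        (_ : NormedAddCommGroup CG) (_ : NormedSpace ℂ CG) (_ : Group G) (_ : TopologicalSpace G) (_ : TopologicalSpace SK)
        (Siso : Perl34.IsolationSetting H (Lp ℂ 2 V.autMeasure) CG G SK SigIdx SigIdxG),
        S.TranslateClosed (Transposition.Model.heckeFamily exists_isReal_hodgeModel_holds hodgePQ_independent_of_hodgeModel_holds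
          BallQuotient.ballQuotientUniformised_holds cmAbelianVarietyRealised_holds) ∧
        (∀ (Γ : Level V) (ω₁ ω₂ : U.CohC (U.pms F ι₁ V Γ) 1), ω₁ ∈ S.Theta 0 Γ → ω₂ ∈ S.Theta 1 Γ →
          embOf exists_isReal_hodgeModel_holds hodgePQ_independent_of_hodgeModel_holds hU cmAbelianVarietyRealised_holds Γ (U.cup2C (U.pms F ι₁ V Γ) 1 ω₁ ω₂) ≠ 0 →
            ∃ u ∈ Siso.t12.S12, ⟪embOf exists_isReal_hodgeModel_holds hodgePQ_independent_of_hodgeModel_holds hU cmAbelianVarietyRealised_holds Γ (U.cup2C (U.pms F ι₁ V Γ) 1 ω₁ ω₂), u⟫_ℂ ≠ 0) ∧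
        (∀ χ : Siso.t34.X, Siso.t34.allowed χ → ∀ (Φ : SK) (Γ₁ : Level V) (ω₁ ω₂ : U.CohC (U.pms F ι₁ V Γ₁) 1),
          ω₁ ∈ U.Uiso Γ₁ F (f.psi 0) σ → ω₂ ∈ U.Uiso Γ₁ F (f.psi 1) σ →
            ⟪embOf exists_isReal_hodgeModel_holds hodgePQ_independent_of_hodgeModel_holds hU cmAbelianVarietyRealised_holds Γ₁ (U.cup2C (U.pms F ι₁ V Γ₁) 1 ω₁ ω₂), Siso.t34.ϑ χ Φ⟫_ℂ ≠ 0 →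
              ∃ (Γ : Level V) (ω : Fin 4 → U.CohC (U.pms F ι₁ V Γ) 1), (∀ i, ω i ∈ U.Uiso Γ F (f.psi i) σ) ∧
                ⟪embOf exists_isReal_hodgeModel_holds hodgePQ_independent_of_hodgeModel_holds hU cmAbelianVarietyRealised_holds Γ (U.cup2C (U.pms F ι₁ V Γ) 1 (ω 2) (ω 3)),
                  embOf exists_isReal_hodgeModel_holds hodgePQ_independent_of_hodgeModel_holds hU cmAbelianVarietyRealised_holds Γ (U.cup2C (U.pms F ι₁ V Γ) 1 (ω 0) (ω 1))⟫_ℂ ≠ 0)) := by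
  intro U hU hS hM
  exact jointMeetingDatum_of_supply_of_settingMeetSat _ _ _ _ hS hM

#print axioms jointMeetingDatum_of_supply_of_settingMeetSat
#print axioms jointMeetingDatum_of_supply_of_settingMeetSat_rec

end Model

end Summit.HodgeConjecture.CorCM

end
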